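import Summits.BirchSwinnertonDyer.Rank1Residual.AdditivePotMult.PotMultRankZeroUpperHalfOfProp414
import HarnessLib

/-!
# X3♯(G-ord) ∩ `I₀*` and X3♯(M), rank `0`, `p ∤ #E(ℚ)_tors`, `B = 0` rows: the UPPER half and
# `BSD(E,p)` with Delbourgo 1998 Prop. 4 REPLACED by Greenberg's Prop. 4.14 record + control —
# the reducible twins of T-CTL-UP FILES 3b / 4 (team n1011, row T-CTL-UP, seat p06 GEN 11, FILE 5)

HONEST FRAMING (cell `b2b-bsdres-*`, team n1011, verbatim): prove what is provable now; shrink each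
hard class to its core with data; no claim beyond stated classes. Research route on
CONSTRUCTION-SHAPED X3♯ / X4; ASSEMBLY theorems only — no definition, no named fact, nothing booked,
no residual-map mark moved, no class closed. X3♯(G-ord)/X3♯(M) stay CONSTRUCTION-SHAPED (the typed
`χ_p`-branch inputs / the LOWER half stay OPEN as in additive-p2/p4's ENDs); what changes is ONE named
fact in the binder list. NOTHING of additive-p2/p4's is edited (twins).

## What

The X3 upper-half ENDs (`ClassX3Gord.missingUpperBoundAt_rankZero_of_chiBranch[']` /
`…_of_wuthrichComponent`, `ClassX3M.missingUpperBoundAt_rankZero[_of_chiBranch]`) consume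
`hDel : Delbourgo1998.prop4_rankZero_pow_dvd_constantCoeff` through additive-p4's X3 cores. FILE 3a's
cores are CLASS-AGNOSTIC (`hadd : Addv W p` only; the image hypothesis lives in the pointwise leading
term `hLT`), so the reducible rows need no new core: the Wuthrich-shaped typed inputs
`ChiBranchLeadingTermAt W p` / `ChiBranchLeadingTermOddAt W p` feed them exactly as the Kato-shaped ones
do on X4. On the reducible rows `p ∤ #E(ℚ)_tors` is a genuine binder (`htors`, as in every X3 END of
rows T-CTL-EC / T-CTL-TAM), and Prop. 4.14 / HaMa Cor. (i) ask for nothing else (no irreducibility).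

* `X3RankZeroTwist.missingUpperBoundAt_of_odd_prime_of_prop414` — X3 ∧ `r_an = 0` ∧ (semistable twist
  `W = C • V^{(p*)}`, `V` good ordinary or multiplicative at `p`), every odd `p`, granted the typed
  inputs of both parities: `MissingUpperBoundAt W p` from `h414 + htors + S / hSp / hgood + hB`
  (`c_p(E)` is a `p`-unit on these rows, `not_dvd_tamagawaNumberAt_twist_pm_p`);
* **`ClassX3Gord.missingUpperBoundAt_rankZero_of_chiBranch_of_prop414`**,
  **`…_of_wuthrichComponent_of_prop414 (hWu h414 hGZK hmod hmodD hp2 hX he hr htors S hgood hB)`**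
  (socket T-T3B F7 `GoodModelLine.ClassX3Gord.localTowerKerPrimary_zero_eq_bot`), `…_of_shaAn_unit`,
  capstone **`ClassX3Gord.bsdp_rankZero_of_wuthrichComponent_of_cycLowerBound_tamagawaSharp_of_prop414`**;
* **`ClassX3M.missingUpperBoundAt_rankZero_of_chiBranch_of_prop414`**,
  **`ClassX3M.missingUpperBoundAt_rankZero_of_prop414 (hW16 h414 hT41 hGZK hmod hmodD hX hr htors S hgood hB)`**
  (socket T-T3M `AdditivePotMult.ClassX3M.localTowerKerPrimary_zero_eq_bot`, mod A41), `…_of_shaAn_unit`,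
  capstone **`ClassX3M.bsdp_rankZero_of_facts_of_cycLowerBound_tamagawaSharp_of_prop414`**.

Binder diff against the additive-p2/p4 ENDs: REMOVED {`hDel`}, ADDED {`h414`, `htors`, `S`, `hgood`,
`hB : p ∤ Tam(E)`} (+ `hT41` on X3♯(M), already in that class's lower half). RIDER u-2 (referee-1
R12.1, displayed as ruled): the Prop. 4.14 record is NEVER instantiated on potentially supersingular
rows (classes O5 / O6) — X3♯(G-ord) (`TypeGOrd`: good ORDINARY reduction over a subfield of `ℚ(μ_p)`)
and X3♯(M) (`ord_p j < 0`) sit inside the printed scope (potentially ordinary / multiplicative at `p`).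
NOT claimed: `B ≥ 1` rows; rows with `p ∣ #E(ℚ)_tors`. Axioms standard.

References: [Wuthrich2014] Thm. 16; [GreenbergLNM1716] Prop. 4.14, §4 Thm. 4.1; [Delbourgo1998]
Prop. 4 (REPLACED); [HachimoriMatsuno2000] Cor. (i); [Miller2011LMS] Def. 1.1; cells/n1011/skel/T-CTL-UP.md.
-/

noncomputable section

open scoped Classical MatrixGroups ModularForm NumberField

open CongruenceSubgroup WeierstrassCurve NumberField Literature.NumberTheory.EllipticCurves
  Literature.NumberTheory.EllipticCurves.ModularForms
  Literature.NumberTheory.EllipticCurves.Rank1Residual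
  Literature.NumberTheory.EllipticCurves.Rank1Residual.Typed
  IsDedekindDomain Rat.HeightOneSpectrum
  Summit.BirchSwinnertonDyer.Rank1Residual.Iwasawa

namespace Summit.BirchSwinnertonDyer.Rank1Residual.Additive

section X3

variable (W : WeierstrassCurve ℚ) [W.IsElliptic] [W.IsGloballyMinimal] (p : ℕ) [hp : Fact p.Prime]

/-- **X3 ∧ `r_an = 0` ∧ (semistable twist by `p*`), every odd `p`, `p ∤ #E(ℚ)_tors`, `p ∤ Tam(E)`:
`Typed.MissingUpperBoundAt W p`** granted the typed inputs `ChiBranchLeadingTermAt W p` (used iff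
`p ≡ 1 (mod 4)`) / `ChiBranchLeadingTermOddAt W p` (iff `p ≡ 3 (mod 4)`), from Greenberg's Prop. 4.14
record + control (FILE 3a's class-agnostic cores fed with the Wuthrich-shaped leading terms; `c_p(E)`
a `p`-unit on these rows). Twin of additive-p4's `X3RankZeroTwist.missingUpperBoundAt_of_odd_prime_of_semistableTwist`
with `hDel ↦ (h414, htors, S, hSp, hgood, hB)`. [cite: Wuthrich2014, Thm. 16 (p. 397) (shape only)]
[cite: GreenbergLNM1716, Prop. 4.14] -/
theorem X3RankZeroTwist.missingUpperBoundAt_of_odd_prime_of_prop414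
    (h414 : Greenberg1999.prop414_noFiniteSubmodule_of_not_dvd_torsionOrder)
    (hGZK : rank_eq_analyticRank_of_analyticRank_le_one) (hmod : hasEntireLFunction_rat)
    (hBCeven : ChiBranchLeadingTermAt W p) (hBCodd : ChiBranchLeadingTermOddAt W p)
    (hp2 : p ≠ 2) (hr : W.analyticRank = 0) (hX : ClassX3 W p) (htors : ¬ p ∣ W.torsionOrder)
    (S : Finset (HeightOneSpectrum (𝓞 ℚ)))
    (hSp : ∀ κ : ZpExtension ℚ p, κ.IsCyclotomic → ∀ v ∈ S, (p : 𝓞 ℚ) ∈ v.asIdeal →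
      Finite (W.localTowerKerPrimary κ (v.adicCompletion ℚ) 0))
    (hgood : ∀ v ∉ S, (p : 𝓞 ℚ) ∉ v.asIdeal ∧ W.HasGoodReductionAt v) (hB : ¬ p ∣ W.tamagawaProduct)
    (V : WeierstrassCurve ℚ) [V.IsElliptic] [V.IsGloballyMinimal]
    (C : VariableChange ℚ) (hC : C • V.quadraticTwist ((-1 : ℚ) ^ (p / 2) * p) = W)
    (hV : GoodOrd V p ∨ Mult V p)
    {N : ℕ} [NeZero N] {f : CuspForm (Gamma0 N) 2} (hf : IsNewformOf V f)
    (ϖp : ℚ) (hϖp : (ϖp : ℝ) * V.realPeriodRat = plusPeriod f)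
    (ϖm : ℚ) (hϖm : (ϖm : ℝ) * V.imaginaryPeriodRat = minusPeriod f) :
    MissingUpperBoundAt W p := by
  have hdivAt := shaDvdAt_of_prop414 W p h414 htors S hSp hgood hB
  have hodd : p % 4 = 1 ∨ p % 4 = 3 := by
    obtain ⟨k, hk⟩ := hp.out.odd_of_ne_two hp2
    omega
  rcases hodd with h1 | h3
  · have hC' : C • V.quadraticTwist (p : ℚ) = W := by
      rw [pStar_eq_of_mod_four p (Or.inl h1), if_pos h1] at hC
      exact hC
    exact AdditiveTwistEven.missingUpperBoundAt_of_leadingTerm_of_shaDvd W p hdivAt hGZK hmod h1 hr hX.2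
      V C hC' hV hf ϖp hϖp
      fun _ _ hκ hγ hγ' D ↦ (hBCeven V h1 ⟨C, hC'⟩ hV hX.1 hκ hγ hγ' hf D ϖp hϖp).2
  · have hC' : C • V.quadraticTwist (-(p : ℚ)) = W := by
      rw [pStar_eq_of_mod_four p (Or.inr h3), if_neg (by omega)] at hC
      exact hC
    have hC'' : C • V.quadraticTwist (((-(p : ℤ)) : ℤ) : ℚ) = W := by push_cast; exact hC'
    have hu : padicValRat p (C.u : ℚ) = 0 :=
      padicValRat_u_eq_zero_of_twist_pm_p p hp2 V W (hV.elim (fun h ↦ Or.inl h.1) Or.inr)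
        (Or.inr rfl) C hC''
    obtain ⟨q, hq, hle⟩ := AdditiveTwistOdd.shaOrder_le_of_leadingTerm_of_shaDvd W p hdivAt hGZK hmod
      h3 hr hX.2 V C hC' hu hf ϖm hϖm
      fun _ _ hκ hγ hγ' D ↦ (hBCodd V h3 ⟨C, hC'⟩ hV hX.1 hκ hγ hγ' hf D ϖm hϖm).2
    have htam := not_dvd_tamagawaNumberAt_twist_pm_p p hp2 V (hV.elim (fun h ↦ Or.inl h.1) Or.inr)
      (d := -(p : ℚ)) (Or.inr rfl) C hC'
    refine ⟨q, hq, ?_⟩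
    rw [padicValNat.eq_zero_of_not_dvd htam, Nat.cast_zero, add_zero] at hle
    exact hle

end X3

/-! ### X3♯(G-ord) ∩ `I₀*` -/

section X3Gord

variable {W : WeierstrassCurve ℚ} [W.IsElliptic] [W.IsGloballyMinimal] {p : ℕ} [hp : Fact p.Prime]

/-- **X3♯(G-ord) ∩ `I₀*` (odd `p`), `r_an = 0`, `p ∤ #E(ℚ)_tors`, `p ∤ Tam(E)`: `Typed.MissingUpperBoundAt W p`
from the typed `χ_p`-branch inputs, with Delbourgo 1998 Prop. 4 REPLACED by Greenberg's Prop. 4.14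
record** — twin of additive-p2's `ClassX3Gord.missingUpperBoundAt_rankZero_of_chiBranch'` (good-ordinary
twist model `ClassX3Gord.exists_goodOrd_pStar_twist_model`; socket T-T3B F7).
[cite: GreenbergLNM1716, Prop. 4.14] [cite: EdixhovenManin1991, §1] -/
theorem ClassX3Gord.missingUpperBoundAt_rankZero_of_chiBranch_of_prop414
    (h414 : Greenberg1999.prop414_noFiniteSubmodule_of_not_dvd_torsionOrder)
    (hGZK : rank_eq_analyticRank_of_analyticRank_le_one) (hmod : hasEntireLFunction_rat)
    (hmodD : nonempty_modularParametrizationData)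
    (hBCeven : ChiBranchLeadingTermAt W p) (hBCodd : ChiBranchLeadingTermOddAt W p)
    (hp2 : p ≠ 2) (hX : ClassX3Gord W p) (he : semistabilityIndex W p = 2) (hr : W.analyticRank = 0)
    (htors : ¬ p ∣ W.torsionOrder) (S : Finset (HeightOneSpectrum (𝓞 ℚ)))
    (hgood : ∀ v ∉ S, (p : 𝓞 ℚ) ∉ v.asIdeal ∧ W.HasGoodReductionAt v) (hB : ¬ p ∣ W.tamagawaProduct) :
    MissingUpperBoundAt W p := by
  obtain ⟨V, iV, iVm, C, hV, hC⟩ := hX.exists_goodOrd_pStar_twist_model W p hp2 he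
  haveI : NeZero (V.conductorNorm ℤ) := ⟨(V.conductorNorm_pos_holds).ne'⟩
  obtain ⟨Dm⟩ := hmodD V
  obtain ⟨ϖ, -, hϖ, -⟩ := Dm.exists_rat_mul_realPeriodRat_eq_plusPeriod
  obtain ⟨ϖ', -, hϖ'⟩ := exists_rat_mul_imaginaryPeriodRat_eq_minusPeriod Dm
  exact X3RankZeroTwist.missingUpperBoundAt_of_odd_prime_of_prop414 W p h414 hGZK hmod hBCeven hBCodd hp2
    hr hX.classX3 htors S
    (fun κ _ v _ hpv ↦ by
      rw [GoodModelLine.ClassX3Gord.localTowerKerPrimary_zero_eq_bot hp2 hX hpv κ]; infer_instance)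
    hgood hB V C hC (Or.inl hV) Dm.isNewformOf ϖ hϖ ϖ' hϖ'

/-- **X3♯(G-ord) ∩ `I₀*` (odd `p`), `r_an = 0`, `p ∤ #E(ℚ)_tors`, `p ∤ Tam(E)`: the UPPER half from the
named facts {Wuthrich 2014 Thm. 16 component reading (`hWu`), GREENBERG PROP. 4.14, GZK, modularity} —
Delbourgo 1998 Prop. 4 NOT among them** (additive-p2's `…_of_wuthrichComponent` with
`hDel ↦ (h414, htors, S, hgood, hB)`). [cite: Wuthrich2014, Thm. 16 (p. 397)] [cite: GreenbergLNM1716, Prop. 4.14] -/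
theorem ClassX3Gord.missingUpperBoundAt_rankZero_of_wuthrichComponent_of_prop414
    (hWu : Wuthrich2014.charIdeal_dvd_padicLFunctionBranch_component)
    (h414 : Greenberg1999.prop414_noFiniteSubmodule_of_not_dvd_torsionOrder)
    (hGZK : rank_eq_analyticRank_of_analyticRank_le_one) (hmod : hasEntireLFunction_rat)
    (hmodD : nonempty_modularParametrizationData)
    (hp2 : p ≠ 2) (hX : ClassX3Gord W p) (he : semistabilityIndex W p = 2) (hr : W.analyticRank = 0)
    (htors : ¬ p ∣ W.torsionOrder) (S : Finset (HeightOneSpectrum (𝓞 ℚ)))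
    (hgood : ∀ v ∉ S, (p : 𝓞 ℚ) ∉ v.asIdeal ∧ W.HasGoodReductionAt v) (hB : ¬ p ∣ W.tamagawaProduct) :
    MissingUpperBoundAt W p :=
  ClassX3Gord.missingUpperBoundAt_rankZero_of_chiBranch_of_prop414 h414 hGZK hmod hmodD
    (chiBranchLeadingTermAt_of_wuthrichComponent W p hWu
      (padicValRat_j_nonneg_of_typeGOrd W p hX.typeGOrd))
    (chiBranchLeadingTermOddAt_of_wuthrichComponent W p hWu
      (padicValRat_j_nonneg_of_typeGOrd W p hX.typeGOrd))
    hp2 hX he hr htors S hgood hB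

/-- **… and `BSD(E,p)` on the `p ∤ #Ш_an(E)` rows** (Delbourgo-free fact list).
[cite: Wuthrich2014, Thm. 16 (p. 397)] [cite: GreenbergLNM1716, Prop. 4.14] -/
theorem ClassX3Gord.bsdp_rankZero_of_wuthrichComponent_of_prop414_of_shaAn_unit
    (hWu : Wuthrich2014.charIdeal_dvd_padicLFunctionBranch_component)
    (h414 : Greenberg1999.prop414_noFiniteSubmodule_of_not_dvd_torsionOrder)
    (hGZK : rank_eq_analyticRank_of_analyticRank_le_one) (hmod : hasEntireLFunction_rat)
    (hmodD : nonempty_modularParametrizationData)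
    (hp2 : p ≠ 2) (hX : ClassX3Gord W p) (he : semistabilityIndex W p = 2) (hr : W.analyticRank = 0)
    (htors : ¬ p ∣ W.torsionOrder) (S : Finset (HeightOneSpectrum (𝓞 ℚ)))
    (hgood : ∀ v ∉ S, (p : 𝓞 ℚ) ∉ v.asIdeal ∧ W.HasGoodReductionAt v) (hB : ¬ p ∣ W.tamagawaProduct)
    {q : ℚ} (hq : shaAn W = (q : ℂ)) (hv : padicValRat p q = 0) : BSDp W p :=
  bsdp_of_missingPPartAt W p hGZK (by rw [hr]; exact zero_le_one)
    (missingPPartAt_of_upper_of_shaAn_unit W p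
      (ClassX3Gord.missingUpperBoundAt_rankZero_of_wuthrichComponent_of_prop414 hWu h414 hGZK hmod hmodD
        hp2 hX he hr htors S hgood hB) hq hv)

/-- **CAPSTONE — X3♯(G-ord) ∩ `I₀*` (odd `p`), `r_an = 0`, `p ∤ #E(ℚ)_tors`, `p ∤ Tam(E)`: `BSD(E,p)`
from the typed LOWER input `CycLowerBoundAt W p Dh` and the named facts {Wuthrich Thm. 16 component,
Greenberg Prop. 4.14, GZK, modularity} — NO Delbourgo 1998 / 2002**: lower half = T-CTL-TAM♯'s
`ClassX3Gord.missingLowerBoundAt_rankZero_of_cycLowerBound_tamagawaSharp`, upper half this file. X3♯(G-ord)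
stays CONSTRUCTION-SHAPED; nothing booked. [cite: Wuthrich2014, Thm. 16 (p. 397)]
[cite: GreenbergLNM1716, §3 Lemma 3.3, §4 Thm. 4.1 and Prop. 4.14] [cite: Miller2011LMS, Def. 1.1] -/
theorem ClassX3Gord.bsdp_rankZero_of_wuthrichComponent_of_cycLowerBound_tamagawaSharp_of_prop414
    (hWu : Wuthrich2014.charIdeal_dvd_padicLFunctionBranch_component)
    (h414 : Greenberg1999.prop414_noFiniteSubmodule_of_not_dvd_torsionOrder)
    (hGZK : rank_eq_analyticRank_of_analyticRank_le_one) (hmod : hasEntireLFunction_rat)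
    (hmodD : nonempty_modularParametrizationData)
    (hp2 : p ≠ 2) (hX : ClassX3Gord W p) (he : semistabilityIndex W p = 2) (hr : W.analyticRank = 0)
    (htors : ¬ p ∣ W.torsionOrder) (S : Finset (HeightOneSpectrum (𝓞 ℚ)))
    (hgood : ∀ v ∉ S, (p : 𝓞 ℚ) ∉ v.asIdeal ∧ W.HasGoodReductionAt v) (hB : ¬ p ∣ W.tamagawaProduct)
    (Dh : PAdicHeightData W p) (hlow : CycLowerBoundAt W p Dh) : BSDp W p :=
  bsdp_of_missingPPartAt W p hGZK (by rw [hr]; exact zero_le_one)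
    (missingPPartAt_of_lower_of_upper W p
      (ClassX3Gord.missingLowerBoundAt_rankZero_of_cycLowerBound_tamagawaSharp hp2 hX hGZK hr htors S hgood
        Dh hlow)
      (ClassX3Gord.missingUpperBoundAt_rankZero_of_wuthrichComponent_of_prop414 hWu h414 hGZK hmod hmodD
        hp2 hX he hr htors S hgood hB))

end X3Gord

end Summit.BirchSwinnertonDyer.Rank1Residual.Additive

/-! ### X3♯(M) -/

namespace Summit.BirchSwinnertonDyer.Rank1Residual.AdditivePotMult

open Additive

variable {W : WeierstrassCurve ℚ} [W.IsElliptic] [W.IsGloballyMinimal] {p : ℕ} [hp : Fact p.Prime]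

/-- **X3♯(M), `r_an = 0`, `p ∤ #E(ℚ)_tors`, `p ∤ Tam(E)`: `Typed.MissingUpperBoundAt W p` from the typed
`χ_p`-branch inputs, with Delbourgo 1998 Prop. 4 REPLACED by Greenberg's Prop. 4.14 record** — twin of
additive-p4's `ClassX3M.missingUpperBoundAt_rankZero_of_chiBranch` (multiplicative twist model
`ClassX3M.exists_mult_pStar_twist_model`; socket above `p` T-T3M mod A41, `hT41`).
[cite: GreenbergLNM1716, Prop. 4.14] [cite: Wuthrich2014, Thm. 16 (p. 397) (shape only)] -/
theorem ClassX3M.missingUpperBoundAt_rankZero_of_chiBranch_of_prop414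
    (h414 : Greenberg1999.prop414_noFiniteSubmodule_of_not_dvd_torsionOrder)
    (hT41 : Silverman1994_thmV53_corV54_tateUniformisation.{0})
    (hGZK : rank_eq_analyticRank_of_analyticRank_le_one) (hmod : hasEntireLFunction_rat)
    (hmodD : nonempty_modularParametrizationData)
    (hBCeven : ChiBranchLeadingTermAt W p) (hBCodd : ChiBranchLeadingTermOddAt W p)
    (hX : ClassX3M W p) (hr : W.analyticRank = 0) (htors : ¬ p ∣ W.torsionOrder)
    (S : Finset (HeightOneSpectrum (𝓞 ℚ)))
    (hgood : ∀ v ∉ S, (p : 𝓞 ℚ) ∉ v.asIdeal ∧ W.HasGoodReductionAt v) (hB : ¬ p ∣ W.tamagawaProduct) :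
    MissingUpperBoundAt W p := by
  obtain ⟨V, iV, iVm, C, hV, hC⟩ := hX.exists_mult_pStar_twist_model
  haveI : NeZero (V.conductorNorm ℤ) := ⟨(V.conductorNorm_pos_holds).ne'⟩
  obtain ⟨Dm⟩ := hmodD V
  obtain ⟨ϖ, -, hϖ, -⟩ := Dm.exists_rat_mul_realPeriodRat_eq_plusPeriod
  obtain ⟨ϖ', -, hϖ'⟩ := exists_rat_mul_imaginaryPeriodRat_eq_minusPeriod Dm
  exact X3RankZeroTwist.missingUpperBoundAt_of_odd_prime_of_prop414 W p h414 hGZK hmod hBCeven hBCodd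
    hX.p_ne_two hr hX.classX3 htors S
    (fun κ _ v _ hpv ↦ by
      rw [AdditivePotMult.ClassX3M.localTowerKerPrimary_zero_eq_bot hT41 hX hpv κ]; infer_instance)
    hgood hB V C hC (Or.inr hV) Dm.isNewformOf ϖ hϖ ϖ' hϖ'

/-- **X3♯(M) ∧ `r_an(E) = 0` ∧ `p ∤ #E(ℚ)_tors` ∧ `p ∤ Tam(E)`, ANY odd `p`: the upper half from
published theorems + kernel glue, with Delbourgo 1998 Prop. 4 REPLACED by Greenberg's Prop. 4.14
record** — fact list {Wuthrich 2014 Thm. 16 half-eigenspace reading (`hW16`), Prop. 4.14, A41, GZK,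
modularity}; twin of additive-p4's `ClassX3M.missingUpperBoundAt_rankZero` with
`hDel ↦ (h414, hT41, htors, S, hgood, hB)`. [cite: Wuthrich2014, Thm. 16 (p. 397) and §3 (p. 390)]
[cite: GreenbergLNM1716, Prop. 4.14] -/
theorem ClassX3M.missingUpperBoundAt_rankZero_of_prop414
    (hW16 : Wuthrich2014.thm16_halfEigenCharIdeal_dvd_cyclotomicPrime)
    (h414 : Greenberg1999.prop414_noFiniteSubmodule_of_not_dvd_torsionOrder)
    (hT41 : Silverman1994_thmV53_corV54_tateUniformisation.{0})
    (hGZK : rank_eq_analyticRank_of_analyticRank_le_one) (hmod : hasEntireLFunction_rat)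
    (hmodD : nonempty_modularParametrizationData)
    (hX : ClassX3M W p) (hr : W.analyticRank = 0) (htors : ¬ p ∣ W.torsionOrder)
    (S : Finset (HeightOneSpectrum (𝓞 ℚ)))
    (hgood : ∀ v ∉ S, (p : 𝓞 ℚ) ∉ v.asIdeal ∧ W.HasGoodReductionAt v) (hB : ¬ p ∣ W.tamagawaProduct) :
    MissingUpperBoundAt W p :=
  ClassX3M.missingUpperBoundAt_rankZero_of_chiBranch_of_prop414 h414 hT41 hGZK hmod hmodD
    ((ClassX3M.potMult W p hX).chiBranchLeadingTermAt_of_halfFact hW16)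
    ((ClassX3M.potMult W p hX).chiBranchLeadingTermOddAt_of_halfFact hW16) hX hr htors S hgood hB

/-- **… and `BSD(E,p)` on the `p ∤ #Ш_an(E)` rows** (Delbourgo-free fact list).
[cite: Wuthrich2014, Thm. 16 (p. 397)] [cite: GreenbergLNM1716, Prop. 4.14] -/
theorem ClassX3M.bsdp_rankZero_of_prop414_of_shaAn_unit
    (hW16 : Wuthrich2014.thm16_halfEigenCharIdeal_dvd_cyclotomicPrime)
    (h414 : Greenberg1999.prop414_noFiniteSubmodule_of_not_dvd_torsionOrder)
    (hT41 : Silverman1994_thmV53_corV54_tateUniformisation.{0})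
    (hGZK : rank_eq_analyticRank_of_analyticRank_le_one) (hmod : hasEntireLFunction_rat)
    (hmodD : nonempty_modularParametrizationData)
    (hX : ClassX3M W p) (hr : W.analyticRank = 0) (htors : ¬ p ∣ W.torsionOrder)
    (S : Finset (HeightOneSpectrum (𝓞 ℚ)))
    (hgood : ∀ v ∉ S, (p : 𝓞 ℚ) ∉ v.asIdeal ∧ W.HasGoodReductionAt v) (hB : ¬ p ∣ W.tamagawaProduct)
    {q : ℚ} (hq : shaAn W = (q : ℂ)) (hv : padicValRat p q = 0) : BSDp W p :=
  bsdp_of_missingPPartAt W p hGZK (by rw [hr]; exact zero_le_one)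
    (missingPPartAt_of_upper_of_shaAn_unit W p
      (ClassX3M.missingUpperBoundAt_rankZero_of_prop414 hW16 h414 hT41 hGZK hmod hmodD hX hr htors S hgood
        hB) hq hv)

/-- **CAPSTONE — X3♯(M) ∧ `r_an(E) = 0` ∧ `p ∤ #E(ℚ)_tors` ∧ `p ∤ Tam(E)`, every odd `p`: `BSD(E,p)`
from the typed LOWER input `CycLowerBoundAt W p Dh` and the named facts {A41, Greenberg Prop. 4.14,
GZK, modularity, Wuthrich Thm. 16 half-eigenspace} — NO Delbourgo 1998 / 2002**: lower half =
T-CTL-TAM♯'s `ClassX3M.missingLowerBoundAt_rankZero_of_cycLowerBound_tamagawaSharp`, upper half this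
file. X3♯(M) stays CONSTRUCTION-SHAPED; nothing booked. [cite: Wuthrich2014, Thm. 16 (p. 397)]
[cite: GreenbergLNM1716, §3 Lemma 3.3, §4 Thm. 4.1 and Prop. 4.14] [cite: Miller2011LMS, Def. 1.1] -/
theorem ClassX3M.bsdp_rankZero_of_facts_of_cycLowerBound_tamagawaSharp_of_prop414
    (hW16 : Wuthrich2014.thm16_halfEigenCharIdeal_dvd_cyclotomicPrime)
    (h414 : Greenberg1999.prop414_noFiniteSubmodule_of_not_dvd_torsionOrder)
    (hT41 : Silverman1994_thmV53_corV54_tateUniformisation.{0})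
    (hGZK : rank_eq_analyticRank_of_analyticRank_le_one) (hmod : hasEntireLFunction_rat)
    (hmodD : nonempty_modularParametrizationData)
    (hX : ClassX3M W p) (hr : W.analyticRank = 0) (htors : ¬ p ∣ W.torsionOrder)
    (S : Finset (HeightOneSpectrum (𝓞 ℚ)))
    (hgood : ∀ v ∉ S, (p : 𝓞 ℚ) ∉ v.asIdeal ∧ W.HasGoodReductionAt v) (hB : ¬ p ∣ W.tamagawaProduct)
    (Dh : PAdicHeightData W p) (hlow : CycLowerBoundAt W p Dh) : BSDp W p :=
  bsdp_of_missingPPartAt W p hGZK (by rw [hr]; exact zero_le_one)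
    (missingPPartAt_of_lower_of_upper W p
      (Additive.ClassX3M.missingLowerBoundAt_rankZero_of_cycLowerBound_tamagawaSharp hT41 hX hGZK hr htors S
        hgood Dh hlow)
      (ClassX3M.missingUpperBoundAt_rankZero_of_prop414 hW16 h414 hT41 hGZK hmod hmodD hX hr htors S hgood
        hB))

end Summit.BirchSwinnertonDyer.Rank1Residual.AdditivePotMult

end
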